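/-
Copyright (c) 2026 the pub-hodgecm-mathlib formalisation cell (harness21).  Prover seat hodgecm-mathlib-R90-CS-p03 (g0), Track B ∕ K2-LIT, h413 = `stmt-HodgeConjecture-24833`,
R90-TF section S8 «ContSpec-n½» (planner R90-CS-plan (g0), hand «p06-frame» 15:48:56Z): the PAYMENT FRAME of socket S8B#6 `sock_S8_res_cuspidal_of_not_piN` of file B
`R90_S8_ResidualSpectrumU3B`, with the residual classification (S8B#2) as a HYPOTHESIS and the `πⁿ(ξ)`-predicate ABSTRACTED.
-/
import Summits.HodgeConjecture.HodgeConjecture.Theorems.R90S8UnitarySchurDichotomy      -- ★ S8B#7 `R90.S8.isOrtho_or_equiv_of_isTopIrreducible` (p861493); brings ★ `HilbertRepSpectrumProofs`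
import Summits.HodgeConjecture.HodgeConjecture.Theorems.R90S8OrthoLeft                   -- ★ S8B#7b `R90.S8.le_left_of_isOrtho_right` (p861476)
import Summits.HodgeConjecture.HodgeConjecture.Theorems.K2E1CuspidalSpectrumUnitaryDefs  -- ★ `residualSubspace` = `L²_disc ⊓ (L²_cusp)ᗮ`, ★ `cuspidalSubspace_sup_residualSubspace`, ★ `isOrtho_cuspidalSubspace_residualSubspace`; brings ★ `CuspidalSpectrumDiscrete` (`cuspidalSubspace`, `cuspidalSubspace_le_discreteSpectrum`) and ★ `AutomorphicSpectrum` (`DiscreteAutomorphicRep`)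
import HarnessLib

/-!
# S8B#6 frame — `R90S8ResCuspidalOfClassification`: a discrete constituent that is neither one-dimensional nor residual-labelled is cuspidal, GIVEN the
# classification of the residual spectrum

Track B ∕ K2-LIT, crux h413 = `stmt-HodgeConjecture-24833`, route of record `HCCMUnconditional`; cell `hodgecm-mathlib`, R90-TF programme, section S8
«ContSpec-n½» (§13.9 residual spectrum), hand «p06-frame» of R90-CS-plan (g0): the Hilbert-space FRAME through which file B pays its socket S8B#6
`sock_S8_res_cuspidal_of_not_piN` ([Rogawski1990] Thm. 13.3.6 (a) p. 202 with §13.9 p. 229, absolute form) from its TOP socket S8B#2 `sock_S8_res_classification`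
(§13.9 (i)∕(ii)) and its support #9 `isPiN_of_equiv`, WITHOUT any Theorems file importing a Lines file (law L9).  THEOREMS ONLY (no `def`, no `instance`, no
`notation`, no named-fact hypothesis, no `sorry`; default heartbeats); lane `--supports stmt-HodgeConjecture-24833 --as helper` (count-neutral).  The residual
classification and the `πⁿ(ξ)`-label enter as HYPOTHESES (`h2`, `Q`, `hQ`): this file proves the bookkeeping, not the number theory.

THE MATHEMATICS ([Dixmier1977] §5.4, §13.1; [MoeglinWaldspurger1995] I.2.18 for `L²_disc = L²_cusp ⊕ L²_res`).  Let `π` be a unitary representation of `G` on a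
Hilbert space, `A ⟂ B` closed invariant subspaces, `Q` a property of closed invariant subspaces invariant under unitary equivalence, and suppose every irreducible
closed invariant `P′ ≤ B` is one-dimensional or satisfies `Q` («classification of `B`»).  Let `P ≤ A + B` be irreducible, NOT one-dimensional and NOT `Q`.  By the
unitary Schur dichotomy (★ S8B#7 `isOrtho_or_equiv_of_isTopIrreducible`: the isometric part of the compressed projection `P_B|_P`) either `P ⟂ B` — and then
`P ≤ A` (★ S8B#7b `le_left_of_isOrtho_right`) — or `P` is unitarily equivalent to an irreducible `P′ ≤ B`; in the latter case `P′` is one-dimensional (then so is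
`P`, dimensions being invariant under linear isomorphism) or `Q P′` (then `Q P` by transport) — both excluded.  Hence `P ≤ A`.  AUTOMORPHIC READING (§2), for ANY
adelic datum `𝒢`, automorphic measure `μ` and family of unipotent radicals `𝔓`: `A = L²_cusp` (★ `cuspidalSubspace`), `B = L²_res = L²_disc ⊓ (L²_cusp)ᗮ`
(★ `residualSubspace`), `A ⟂ B` (★ `isOrtho_cuspidalSubspace_residualSubspace`), `L²_disc = A ⊕ B` as soon as `L²_cusp ≤ L²_disc` (★
`cuspidalSubspace_sup_residualSubspace`; under GGPS ★ `cuspidalSubspace_le_discreteSpectrum`), and every discrete automorphic `P` lies in `L²_disc`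
(★ `DiscreteAutomorphicRep.le_discreteSpectrum`): so a discrete automorphic representation which is not one-dimensional (★ `IsOneDimensional`) and carries no
residual label `Q` is CUSPIDAL, granted the classification «every irreducible of `L²_res` is one-dimensional or `Q`».  For `U(3)`: `Q P := ∃ ξ, IsPiN P μω hμu ξ`
(file B), `hQ` = B's #9, `h2` = B's S8B#2 — Rogawski's «π ∈ Π(ξ), π_v ≠ πⁿ(ξ_v) somewhere, dim π > 1 ⟹ π cuspidal» (Thm. 13.3.6 (a)).
* §1 **`le_left_of_classification`** — the abstract Hilbert-space frame (any unitary `π`, any `A ⟂ B`);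
* §2 **`discreteAutomorphicRep_le_cuspidalSubspace_of_classification`** (hypothesis `L²_cusp ≤ L²_disc`) and
  **`discreteAutomorphicRep_le_cuspidalSubspace_of_cuspidalSpectrumDiscrete`** (GGPS BY NAME, ★ `CuspidalSpectrumDiscrete`) — the automorphic heads, in file B's
  currency (`hQ` binder-for-binder the shape of B's #9 `isPiN_of_equiv`, `h2` the shape of B's #2 conclusion `P.IsOneDimensional ∨ …`).
HONEST LABEL: HC_CM is proved only modulo the 7 printed citations (2 remaining named inputs: hLiu418 = `stmt-HodgeConjecture-24832`, h413 = `stmt-HodgeConjecture-24833`) until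
rung 0 closes; this file asserts no named fact and closes no socket (the classification S8B#2 stays a socket of file B); count-neutral.

## References
* [Rogawski1990] J. Rogawski, *Automorphic representations of unitary groups in three variables*, Ann. of Math. Stud. 123 (1990), Thm. 13.3.6 (a) p. 202; §13.9 p. 229.
* [MoeglinWaldspurger1995] C. Mœglin, J.-L. Waldspurger, *Spectral decomposition and Eisenstein series*, Cambridge Tracts 113 (1995), I.2.18.
* [Dixmier1977] J. Dixmier, *C\*-algebras* (North-Holland, 1977), §5.4, §13.1.
-/

set_option autoImplicit false
set_option linter.dupNamespace false  -- the mandated namespace `…HodgeConjecture.HodgeConjecture.R90.S8` (LEAD #1 L1) repeats the summit's segment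

noncomputable section

open MeasureTheory NumberField
open Literature.NumberTheory.Automorphic
open Summit.HodgeConjecture.HodgeConjecture.Cruxes.H413.K2E1CuspidalSpectrumUnitary

namespace Summit.HodgeConjecture.HodgeConjecture.R90.S8

open ContRepresentation

/-! ## §1 The abstract frame: classification of `B` ⟹ an irreducible `P ≤ A ⊕ B` that is neither one-dimensional nor `Q` lies in `A` -/

section Frame

variable {G H : Type*} [Group G] [NormedAddCommGroup H] [InnerProductSpace ℂ H] [CompleteSpace H]
  {π : ContRepresentation ℂ G H}

/-- **S8B#6 frame (abstract).**  `π` unitary, `A ⟂ B` closed subrepresentations, `Q` a property of closed subrepresentations transported along unitary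
equivalence (`hQ`), and the CLASSIFICATION of `B`: every topologically irreducible closed subrepresentation `P′ ≤ B` is one-dimensional or satisfies `Q`
(`h2`).  Then a topologically irreducible closed subrepresentation `P ≤ A ⊔ B` (algebraic sum, as in ★ S8B#7b) which is NOT one-dimensional and does NOT
satisfy `Q` lies in `A`.  Proof: unitary Schur dichotomy ★ `isOrtho_or_equiv_of_isTopIrreducible` against `B`; the orthogonal branch is ★
`le_left_of_isOrtho_right`; in the other branch the equivalent irreducible copy `P′ ≤ B` is one-dimensional (transported back to `P` by
`LinearEquiv.finrank_eq`) or `Q` (transported back by `hQ` along the symmetric equivalence) — contradiction.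
[cite: Dixmier1977, §5.4 and §13.1] [cite: Rogawski1990, Thm. 13.3.6 (a) p. 202] -/
theorem le_left_of_classification (hπ : π.IsUnitary) (A B : ClosedSubrep π)
    (hAB : A.toSubmodule ⟂ B.toSubmodule) (Q : ClosedSubrep π → Prop)
    (hQ : ∀ P P' : ClosedSubrep π, AreUnitarilyEquivalent P.toContRep P'.toContRep → Q P → Q P')
    (h2 : ∀ P' : ClosedSubrep π, P' ≤ B → P'.toContRep.IsTopIrreducible → Module.finrank ℂ P'.toSubmodule = 1 ∨ Q P')
    (P : ClosedSubrep π) (hle : P.toSubmodule ≤ A.toSubmodule ⊔ B.toSubmodule) (hP : P.toContRep.IsTopIrreducible)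
    (h1 : Module.finrank ℂ P.toSubmodule ≠ 1) (hQP : ¬ Q P) : P ≤ A := by
  rcases isOrtho_or_equiv_of_isTopIrreducible hπ B P hP with hPB | ⟨P', hP'B, hP'irr, hequiv⟩
  · -- `P ⟂ B`: the orthogonal branch
    exact le_left_of_isOrtho_right A B P hAB hle hPB
  · -- `P ≅ P' ≤ B`: the classification of `B` applies to `P'`, and both alternatives transport back to `P`
    exfalso
    rcases h2 P' hP'B hP'irr with h1' | hQ'
    · obtain ⟨e, -⟩ := hequiv
      exact h1 (e.toContinuousLinearEquiv.toLinearEquiv.finrank_eq.trans h1')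
    · exact hQP (hQ P' P hequiv.symm hQ')

end Frame

/-! ## §2 The automorphic heads: `A = L²_cusp`, `B = L²_res = L²_disc ⊓ (L²_cusp)ᗮ`, `P` a discrete automorphic representation -/

section Automorphic

universe u

variable {K : Type} [Field K] [NumberField K] (𝒢 : AdelicGroupData.{u} K)
  (μ : Measure 𝒢.automorphicQuotient) [𝒢.IsAutomorphicMeasure μ] (𝔓 : 𝒢.ParabolicUnipotentData)

/-- **S8B#6 frame (automorphic, any datum; hypothesis `L²_cusp ≤ L²_disc`).**  Let `Q` be a property of discrete automorphic representations of `𝒢` in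
`L²(G(K)\G(𝔸_K), μ)` transported along unitary equivalence of the underlying spaces (`hQ`, the shape of file B's #9 `isPiN_of_equiv`), and assume the
CLASSIFICATION OF THE RESIDUAL SPECTRUM along `𝔓`: every discrete automorphic `P′` inside `L²_res = L²_disc ⊓ (L²_cusp)ᗮ` (★ `residualSubspace`) is
one-dimensional or `Q` (`h2`, the shape of file B's S8B#2).  If `L²_cusp ≤ L²_disc`, then every discrete automorphic `P` which is NOT one-dimensional
(★ `DiscreteAutomorphicRep.IsOneDimensional`) and NOT `Q` is CUSPIDAL: `P.space ≤ L²_cusp` (★ `cuspidalSubspace`).  §1 at `A = L²_cusp`, `B = L²_res`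
(`A ⟂ B` ★ `isOrtho_cuspidalSubspace_residualSubspace`, `A ⊔ B = L²_disc` ★ `cuspidalSubspace_sup_residualSubspace`, `P ≤ L²_disc` ★ `le_discreteSpectrum`,
`L²` unitary ★ `isUnitary_rightRegular`). [cite: MoeglinWaldspurger1995, I.2.18] [cite: Rogawski1990, Thm. 13.3.6 (a) p. 202; §13.9 p. 229] -/
theorem discreteAutomorphicRep_le_cuspidalSubspace_of_classification
    (hcusp : 𝒢.cuspidalSubspace μ 𝔓 ≤ 𝒢.discreteSpectrum μ)
    (Q : DiscreteAutomorphicRep 𝒢 μ → Prop)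
    (hQ : ∀ P P' : DiscreteAutomorphicRep 𝒢 μ, AreUnitarilyEquivalent P.space.toContRep P'.space.toContRep → Q P → Q P')
    (h2 : ∀ P' : DiscreteAutomorphicRep 𝒢 μ, P'.space ≤ residualSubspace 𝒢 μ 𝔓 → P'.IsOneDimensional ∨ Q P')
    (P : DiscreteAutomorphicRep 𝒢 μ) (h1 : ¬ P.IsOneDimensional) (hQP : ¬ Q P) :
    P.space ≤ 𝒢.cuspidalSubspace μ 𝔓 := by
  refine le_left_of_classification (𝒢.isUnitary_rightRegular μ) (𝒢.cuspidalSubspace μ 𝔓) (residualSubspace 𝒢 μ 𝔓)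
    (isOrtho_cuspidalSubspace_residualSubspace 𝒢 μ 𝔓) (fun W => ∃ hW : W.toContRep.IsTopIrreducible, Q ⟨W, hW⟩) ?_ ?_ P.space ?_ P.irreducible h1 ?_
  · -- transport of the lifted predicate along unitary equivalence of closed subrepresentations
    rintro W W' he ⟨hW, hQW⟩
    obtain ⟨e, he'⟩ := he
    exact ⟨(isTopIrreducible_congr e).mp hW, hQ ⟨W, hW⟩ ⟨W', (isTopIrreducible_congr e).mp hW⟩ ⟨e, he'⟩ hQW⟩
  · -- the classification of `L²_res`, read on closed subrepresentations
    intro W hWB hW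
    rcases h2 ⟨W, hW⟩ hWB with h | h
    · exact Or.inl h
    · exact Or.inr ⟨hW, h⟩
  · -- `P ≤ L²_disc = L²_cusp ⊔ L²_res`
    rw [cuspidalSubspace_sup_residualSubspace 𝒢 μ 𝔓 hcusp]
    exact ClosedSubrep.toSubmodule_le_iff.mpr P.le_discreteSpectrum
  · -- `¬ Q P`, read on the lifted predicate
    rintro ⟨hW, hQW⟩
    exact hQP hQW

/-- **S8B#6 frame (automorphic, any datum; GGPS BY NAME).**  The same with the hypothesis `L²_cusp ≤ L²_disc` supplied by Gelfand–Graev–Piatetski-Shapiro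
compactness ★ `CuspidalSpectrumDiscrete 𝒢 μ 𝔓` (★ `cuspidalSubspace_le_discreteSpectrum`) — for `U(Φ₃)` this is file B's hypothesis `CmCuspidalSpectrumDiscreteR L 3 μ`
of S8B#6 verbatim (an `abbrev`), so B pays `sock_S8_res_cuspidal_of_not_piN` by `Q P := ∃ ξ, IsPiN P μω hμu ξ`, `hQ` := its #9 `isPiN_of_equiv`, `h2` := its S8B#2
`sock_S8_res_classification … μω hμu hμω`, `hQP := not_exists.2 ‹∀ ξ, ¬ IsPiN P μω hμu ξ›`.
[cite: GelfandGraevPiatetskiShapiro1969, Ch. 3] [cite: MoeglinWaldspurger1995, I.2.18] [cite: Rogawski1990, Thm. 13.3.6 (a) p. 202; §13.9 p. 229] -/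
theorem discreteAutomorphicRep_le_cuspidalSubspace_of_cuspidalSpectrumDiscrete
    [LocallyCompactSpace 𝒢.Adelic] [T2Space 𝒢.Adelic] (h : 𝒢.CuspidalSpectrumDiscrete μ 𝔓)
    (Q : DiscreteAutomorphicRep 𝒢 μ → Prop)
    (hQ : ∀ P P' : DiscreteAutomorphicRep 𝒢 μ, AreUnitarilyEquivalent P.space.toContRep P'.space.toContRep → Q P → Q P')
    (h2 : ∀ P' : DiscreteAutomorphicRep 𝒢 μ, P'.space ≤ residualSubspace 𝒢 μ 𝔓 → P'.IsOneDimensional ∨ Q P')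
    (P : DiscreteAutomorphicRep 𝒢 μ) (h1 : ¬ P.IsOneDimensional) (hQP : ¬ Q P) :
    P.space ≤ 𝒢.cuspidalSubspace μ 𝔓 :=
  discreteAutomorphicRep_le_cuspidalSubspace_of_classification 𝒢 μ 𝔓 (𝒢.cuspidalSubspace_le_discreteSpectrum μ 𝔓 h) Q hQ h2 P h1 hQP

end Automorphic

end Summit.HodgeConjecture.HodgeConjecture.R90.S8

end
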